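import Summits.RiemannHypothesis.RiemannHypothesis.Theorems.PfPersistenceCoefficientRigidityDeletion
import Summits.RiemannHypothesis.RiemannHypothesis.Theorems.PfPersistenceCoefficientRigidityWavePacket
import HarnessLib

/-!
# Coefficient rigidity of window positivity, III-b: the hairline has width ZERO
(pub-rhpf cand-7, gen 9; mechanism/rigidity campaign; no RH claims)

Third part of `PfPersistenceCoefficientRigidity` (part I: the hairline `|λ| ≤ 2ε(r)` for
`r < x₀/2`; part II: prime powers `n ≥ N₀`).  Here the threshold is removed altogether.
ALL STATEMENTS ARE PROVED (no `sorry`, no new axioms, RH only inside a `by_cases`); no sentence of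
this file is DATA.

* `exists_siteQuadratic_neg` — **MAIN THEOREM (RH-free)**: for every site `x₀ > 0` and every real
  `λ ≠ 0` the single-site perturbation `W_{λ,x₀}(F) = W(F) + λ(F(x₀) + F(-x₀))` of Weil's
  explicit-formula functional is negative on some test function: `Re W_{λ,x₀}(g ⋆ g̃) < 0`.
* `siteQuadratic_nonneg_iff` — for `x₀ > 0`:
  `(∀ test g, Re W_{λ,x₀}(g ⋆ g̃) ≥ 0) ↔ (λ = 0 ∧ RiemannHypothesis)`.  The positive set of the
  one-parameter family is `{0}` or `∅`; which of the two is RH itself and is NOT claimed.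
* `deleteTable_not_positivity` — **every** single prime-power deletion (all `n` with `Λ(n) ≠ 0`,
  from `n = 2` on) fails `ExplicitDatum.Positivity`; `not_positivity_of_singleEntry` — changing ANY
  one entry `n₀ ≥ 2` of `ζ`'s weight table (to any other real value) does.

Mechanism (RH branch; the `¬RH` branch is part I's sinking ground energy): the wave packets of
`PfPersistenceCoefficientRigidityWavePacket`.  With the carrier `t₀` off the ordinates the zero side
is `O_{t₀,d}(R⁻²)` while the site term is `2λ cos(t₀x₀) · (≥ R - x₀)` with `λ cos(t₀ x₀) ≤ -|λ|/2`,
so `Re W_{λ,x₀}(g ⋆ g̃) ≤ O(R⁻²) - |λ|(R - x₀) < 0` for large `R`.  No radius constraint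
`r < x₀/2` remains, hence no threshold.  The site `x₀ = 0` is genuinely exceptional
(`F(0) = ‖g‖₂² ≥ 0`), which is why `x₀ > 0` is assumed.

References: E. Bombieri, *Remarks on Weil's quadratic functional in the theory of prime numbers
I*, Rend. Lincei (9) 11 (2000) 183–233, §3; A. Weil (1952).
-/

set_option linter.dupNamespace false

noncomputable section

open Complex Filter Set MeasureTheory
open scoped Real Topology ComplexConjugate

namespace Summit.RiemannHypothesis.RiemannHypothesis.Theorems.PfPersistenceCoefficientRigidity

open Literature.NumberTheory.LFunctions
open Literature.NumberTheory.LFunctions.WeilConverse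
open Summit.RiemannHypothesis.RiemannHypothesis.Theorems.PfPersistenceDownCone
open Summit.RiemannHypothesis.RiemannHypothesis.Theorems.PfPersistenceBarrier

/-! ## §13 The hairline has width zero -/

/-- **RH branch, no threshold**: under RH, for every `x₀ > 0` and every `λ ≠ 0` some test
function has `Re W_{λ,x₀}(g ⋆ g̃) < 0` (a wave packet with carrier off the ordinates).
[this work] -/
theorem exists_siteQuadratic_neg_of_riemannHypothesis_all (hRH : RiemannHypothesis)
    {x₀ lam : ℝ} (hx0 : 0 < x₀) (hlam : lam ≠ 0) :
    ∃ g : ℝ → ℂ, IsWeilTest g ∧ (siteQuadratic lam x₀ g).re < 0 := by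
  obtain ⟨a, b, hab, hcos⟩ := exists_Icc_mul_cos_le hx0 hlam
  obtain ⟨t₀, ht₀, d, hd, hsep⟩ := exists_far_from_ordinates hab
  set S := ∑' ρ : ZetaZeros.riemannZetaNontrivialZeros, weilZeroWeight (ρ : ℂ) with hSdef
  set M := (weilDecayConst plateauC * ((1 + 2 * t₀ ^ 2) * (2 + 1 / d ^ 2))) ^ 2 with hMdef
  have hS : 0 ≤ S := tsum_nonneg fun ρ ↦ weilZeroWeight_nonneg ρ.2
  have hM : 0 ≤ M := sq_nonneg _
  have hlam0 : 0 < |lam| := abs_pos.2 hlam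
  set R := max (2 * x₀) (max 1 (2 * (M * S) / |lam| + 1)) with hRdef
  have hR1 : 1 ≤ R := le_max_of_le_right (le_max_left _ _)
  have hR0 : 0 < R := by linarith
  have hRx : 2 * x₀ ≤ R := le_max_left _ _
  have hRK : 2 * (M * S) / |lam| + 1 ≤ R := le_max_of_le_right (le_max_right _ _)
  have hg := isWeilTest_wavePacket hR0 t₀
  refine ⟨wavePacket R t₀, hg, ?_⟩
  rw [siteQuadratic_re, ← combShapeDetection_zeroForm_eq_weilQuadratic hg, re_weilConv_wavePacket]
  have hZ : (zeroForm (wavePacket R t₀)).re ≤ M / R ^ 2 * S :=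
    re_zeroForm_wavePacket_le hRH hR0 hd hsep
  have hZ' : M / R ^ 2 * S ≤ M * S :=
    mul_le_mul_of_nonneg_right (div_le_self hM (by nlinarith)) hS
  have hI : R - x₀ ≤ ∫ u, plateau (u / R) * plateau ((u - x₀) / R) :=
    plateau_overlap_ge hx0.le hRx hR0
  have hI0 : 0 ≤ ∫ u, plateau (u / R) * plateau ((u - x₀) / R) := by linarith
  have hc := hcos t₀ ht₀
  have h1 : 2 * lam * (Real.cos (t₀ * x₀) * ∫ u, plateau (u / R) * plateau ((u - x₀) / R)) ≤
      -|lam| * (R - x₀) := by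
    have := mul_le_mul_of_nonneg_right hc hI0
    nlinarith [this, hI, hlam0]
  have h2 : M * S < |lam| * (R - x₀) := by
    have hlt : 2 * (M * S) / |lam| < R := by linarith
    rw [div_lt_iff₀ hlam0] at hlt
    nlinarith
  linarith [hZ, hZ', h1, h2]

/-- **MAIN THEOREM — the hairline has width zero (RH-free).**  For every site `x₀ > 0` and every
real `λ ≠ 0`, the single-site perturbation `W_{λ,x₀}` of Weil's functional is negative on some
test function.  Cases: RH (`exists_siteQuadratic_neg_of_riemannHypothesis_all`, wave packets) /
`¬RH` (part I, sinking ground energy).  Nothing about RH is claimed. [this work] -/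
theorem exists_siteQuadratic_neg {x₀ lam : ℝ} (hx0 : 0 < x₀) (hlam : lam ≠ 0) :
    ∃ g : ℝ → ℂ, IsWeilTest g ∧ (siteQuadratic lam x₀ g).re < 0 := by
  by_cases hRH : RiemannHypothesis
  · exact exists_siteQuadratic_neg_of_riemannHypothesis_all hRH hx0 hlam
  · obtain ⟨a, -, g, hg, -, -, hneg⟩ :=
      exists_siteQuadratic_neg_of_not_riemannHypothesis hRH lam x₀ 0
    exact ⟨g, hg, hneg⟩

/-- **The positive set of the family `λ ↦ W_{λ,x₀}` is `{0} ∩ [RH]`** (`x₀ > 0`): positivity on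
test functions holds iff `λ = 0` AND RH.  The second conjunct is Weil's criterion (imported); the
file claims neither RH nor its negation. [this work] -/
theorem siteQuadratic_nonneg_iff {x₀ lam : ℝ} (hx0 : 0 < x₀) :
    (∀ g : ℝ → ℂ, IsWeilTest g → 0 ≤ (siteQuadratic lam x₀ g).re) ↔
      lam = 0 ∧ RiemannHypothesis := by
  constructor
  · intro h
    have hlam : lam = 0 := by
      by_contra hne
      obtain ⟨g, hg, hneg⟩ := exists_siteQuadratic_neg hx0 hne
      exact absurd (h g hg) (not_le.2 hneg)
    subst hlam
    exact ⟨rfl, (siteQuadratic_zero_nonneg_iff_riemannHypothesis x₀).1 h⟩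
  · rintro ⟨rfl, hRH⟩
    exact (siteQuadratic_zero_nonneg_iff_riemannHypothesis x₀).2 hRH

/-- **Width zero**: a single-site perturbation at `x₀ > 0` that is positive on test functions has
`λ = 0` (with no claim that `λ = 0` is positive). [this work] -/
theorem eq_zero_of_siteQuadratic_nonneg {x₀ lam : ℝ} (hx0 : 0 < x₀)
    (h : ∀ g : ℝ → ℂ, IsWeilTest g → 0 ≤ (siteQuadratic lam x₀ g).re) : lam = 0 :=
  ((siteQuadratic_nonneg_iff hx0).1 h).1

/-! ## §14 Every prime-power deletion, every single-entry change of `ζ`'s table -/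

/-- **EVERY PRIME-POWER DELETION IS NON-POSITIVE (RH-free, PROVED)**: for every `n` with
`Λ(n) ≠ 0` (so `n = 2, 3, 4, 5, 7, 8, …`), deleting `n` from `ζ`'s explicit formula gives a
functional negative on some test function. [this work] -/
theorem primePower_deletion_exists_neg_all {n : ℕ} (hΛ : ArithmeticFunction.vonMangoldt n ≠ 0) :
    ∃ g : ℝ → ℂ, IsWeilTest g ∧
      (siteQuadratic (ArithmeticFunction.vonMangoldt n / Real.sqrt n) (Real.log n) g).re < 0 := by
  have hn : 2 ≤ n := (ArithmeticFunction.vonMangoldt_ne_zero_iff.1 hΛ).two_le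
  have hn0 : (0 : ℝ) < n := by exact_mod_cast lt_of_lt_of_le (by norm_num) hn
  have hlog : 0 < Real.log n := Real.log_pos (by exact_mod_cast lt_of_lt_of_le (by norm_num) hn)
  exact exists_siteQuadratic_neg hlog (div_ne_zero hΛ (Real.sqrt_ne_zero'.2 hn0))

/-- **In the campaign's vocabulary**: for every prime power `n`, the deleted datum
`tableDatum (deleteTable {n})` (`PfPersistenceDownCone`) fails `ExplicitDatum.Positivity`.
[this work] -/
theorem deleteTable_not_positivity {n : ℕ} (hΛ : ArithmeticFunction.vonMangoldt n ≠ 0) :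
    ¬ (tableDatum (deleteTable {n})).Positivity := by
  intro hP
  obtain ⟨g, hg, hneg⟩ := primePower_deletion_exists_neg_all hΛ
  have h := hP g hg
  rw [deleteTable_quadratic_eq_siteQuadratic n hg] at h
  exact absurd h (not_le.2 hneg)

/-- A table differing from `ζ`'s at the single entry `n₀` is the site perturbation with
`λ = zetaTable n₀ - w n₀`, `x₀ = log n₀`. [this work] -/
theorem singleEntry_quadratic_eq_siteQuadratic {w : ℕ → ℝ} {n₀ : ℕ}
    (hw : ∀ n, n ≠ n₀ → w n = zetaTable n) {g : ℝ → ℂ} (hg : IsWeilTest g) :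
    (tableDatum w).quadratic g = siteQuadratic (zetaTable n₀ - w n₀) (Real.log n₀) g := by
  obtain ⟨a, -, ha⟩ := hg.exists_tsupport_subset_Icc
  obtain ⟨N₁, hN₁⟩ := exists_window_le_log_succ_half a
  have hsupp : tsupport g ⊆
      Icc (-(Real.log ((max N₁ n₀ : ℕ) + 1 : ℝ) / 2)) (Real.log ((max N₁ n₀ : ℕ) + 1 : ℝ) / 2) := by
    have hmono : Real.log ((N₁ : ℝ) + 1) ≤ Real.log ((max N₁ n₀ : ℕ) + 1 : ℝ) := by
      have h1 : (N₁ : ℝ) ≤ (max N₁ n₀ : ℕ) := by exact_mod_cast le_max_left N₁ n₀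
      exact Real.log_le_log (by positivity) (by linarith)
    exact ha.trans (Icc_subset_Icc (by linarith) (by linarith))
  rw [tableDatum_quadratic_eq_add_sum zetaTable w hg _ hsupp, tableDatum_zetaTable_quadratic,
    siteQuadratic_eq, Finset.sum_eq_single n₀]
  · intro n _ hn
    rw [hw n hn, sub_self, Complex.ofReal_zero, zero_mul]
  · intro h
    exact absurd (Finset.mem_range.2 (Nat.lt_succ_of_le (le_max_right N₁ n₀))) h

/-- **`ζ`'S WEIGHT TABLE IS ISOLATED (RH-free, PROVED)**: changing any single entry `n₀ ≥ 2` of the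
table `n ↦ Λ(n)/√n` to any other real number yields an explicit datum that fails
`ExplicitDatum.Positivity` — deletions (`w n₀ = 0`, `Λ(n₀) ≠ 0`), insertions of fake prime powers
(`Λ(n₀) = 0`, `w n₀ ≠ 0`) and re-weightings alike.  Whether the unchanged table is positive is RH
(not claimed). [this work] -/
theorem not_positivity_of_singleEntry {w : ℕ → ℝ} {n₀ : ℕ} (hn₀ : 2 ≤ n₀)
    (hw : ∀ n, n ≠ n₀ → w n = zetaTable n) (hne : w n₀ ≠ zetaTable n₀) :
    ¬ (tableDatum w).Positivity := by
  intro hP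
  have hlog : 0 < Real.log n₀ := Real.log_pos (by exact_mod_cast lt_of_lt_of_le (by norm_num) hn₀)
  obtain ⟨g, hg, hneg⟩ := exists_siteQuadratic_neg hlog (sub_ne_zero.2 hne.symm)
  have h := hP g hg
  rw [singleEntry_quadratic_eq_siteQuadratic hw hg] at h
  exact absurd h (not_le.2 hneg)

end Summit.RiemannHypothesis.RiemannHypothesis.Theorems.PfPersistenceCoefficientRigidity

end
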